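import Literature.Probability.LatticeModels.UrsellFirstZeroPinned
import Literature.Probability.LatticeModels.LeeYangPinnedPhase
import HarnessLib

/-!
# Camia–Jiang–Newman 2023, Theorem 2 for bridge couplings (proved)

Topic `Literature/Probability/LatticeModels`; sibling PROOF file of `UrsellMonotonicity.lean`
(named fact `CamiaJiangNewman2023_thm2`: the first Lee–Yang zero of `h ↦ ⟨e^{hX}⟩_c` is antitone
in the ferromagnetic couplings — the Nishimori–Griffiths conjecture; the printed proof goes
through CJN Thm 1).  Here the SPECIAL CASE of a *bridge* coupling is proved outright from the
Lee–Yang theorem, via the direct route of `UrsellFirstZeroPinned.lean` (Thm 2 ⇐ the pinned-sign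
inequality NG′ at first zeros) and the analytic inputs of `LeeYangPinnedPhase.lean`:

* `sum_mul_sum_eq_of_decoupled` — for couplings with no entries between `A` and `Aᶜ` the spins on
  the two sides are independent: `(Σ f g w)(Σ w) = (Σ f w)(Σ g w)` for `f` resp. `g` depending
  only on the spins in `A` resp. off `A` (swap of the `Aᶜ`-parts of a pair of configurations).
* `weight_eq_weight_zeroPair_mul` — `w_c = w_{c⁰} (cosh J + σ_uσ_v sinh J)`, `c⁰` = `c` with the
  `(u,v)`, `(v,u)` entries removed, `J = c_{uv} + c_{vu}`.
* `avg_spin_pair_cos_nonpos_of_bridge` — **NG′ for a bridge**: if the only `A`–`Aᶜ` entries of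
  `c ≥ 0` are `(u,v)`, `(v,u)` (`u ∈ A`, `v ∉ A`), then at the first zero `θ⋆` of `⟨cos θX⟩_c`,
  `⟨σ_uσ_v cos θ⋆X⟩_c ≤ 0`.  With `Z₁ = Σ cos(θX_A) w⁰`, `S₁ = Σ σ_u sin(θX_A) w⁰` (and `Z₂, S₂`
  on the other side): `Z_c W⁰ = cosh J·Z₁Z₂ − sinh J·S₁S₂`, `N_c W⁰ = sinh J·Z₁Z₂ − cosh J·S₁S₂`;
  the sides stay positive on `[0,θ⋆)` (a first failure `τ < θ⋆` would give `Z_c(τ) ≤ 0` since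
  `S₁(τ), S₂(τ) ≥ 0` by `avg_spin_mul_sin_nonneg`), hence `S₁(θ⋆), S₂(θ⋆) ≥ 0` and
  `cosh J · N_c(θ⋆) W⁰ = −S₁S₂(θ⋆) ≤ 0`.
* `exists_zero_le_of_raise_of_pinnedSign` — the single-coupling step of
  `UrsellFirstZeroPinned.lean` with NG′ assumed only for the model at hand.
* `CamiaJiangNewman2023_thm2_bridge` — **CJN Thm 2 (zero form) for raising a bridge coupling**:
  every zero `h` of the `c`-mgf has a zero `h'` of the `(c + δ𝟙_{(u,v)})`-mgf with `‖h'‖ ≤ ‖h‖`.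
  In particular Thm 2 holds on forests.  The general case remains the named fact.

This special case and its proof are not in [CamiaJiangNewman2023] (whose proof of Thm 2 rests on
Thm 1); it is recorded in the seat's evidence note `thm2_session6.md` §1.  No definitions, no
named facts.

## References

* [CamiaJiangNewman2023] F. Camia, J. Jiang, C. M. Newman, CMP 401 (2023), arXiv:2207.12247,
  Thm 2 and §1.2.
* [HouJiangNewman2023] Q. Hou, J. Jiang, C. M. Newman, J. Stat. Phys. 190 (2023),
  arXiv:2208.00917, Lemma 3 (the coupling pencil `cosh δ · Z − sinh δ · ∂Z`).
* [Newman1975] C. M. Newman, CMP 41 (1975), Thm 1; [LiebSokal1981] §3 (Lee–Yang inputs, via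
  `LeeYangPinnedPhase.lean`).
-/

noncomputable section

open Finset Complex

namespace Literature.Probability.LatticeModels

namespace PairIsing

variable {ι : Type*} [Fintype ι] [DecidableEq ι]

/-! ### 1. Decoupled couplings: independence of the two sides -/

section Decoupled

variable (A : Finset ι)

omit [Fintype ι] in
/-- Mixing two configurations along `A`: `ρ` on `A`, `ρ'` off `A`. [folklore] -/
theorem mix_mix (ρ ρ' : SpinConfig ι) :
    (fun x => if x ∈ A then (fun y => if y ∈ A then ρ y else ρ' y) x
      else (fun y => if y ∈ A then ρ' y else ρ y) x) = ρ := by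
  funext x
  by_cases hx : x ∈ A <;> simp [hx]

/-- For couplings with no `A`–`Aᶜ` entries the Boltzmann weights of the two mixed configurations
multiply to the same product (the exponent is a sum of `A×A` and `Aᶜ×Aᶜ` terms). [folklore] -/
theorem weight_mix_mul_weight_mix {c : ι → ι → ℝ}
    (hdec : ∀ x y, x ∈ A → y ∉ A → c x y = 0 ∧ c y x = 0) (ρ ρ' : SpinConfig ι) :
    weight c (fun x => if x ∈ A then ρ x else ρ' x) * weight c (fun x => if x ∈ A then ρ' x else ρ x) =
      weight c ρ * weight c ρ' := by
  unfold weight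
  rw [← Real.exp_add, ← Real.exp_add]
  congr 1
  rw [← sum_add_distrib, ← sum_add_distrib]
  refine sum_congr rfl fun x _ => ?_
  rw [← sum_add_distrib, ← sum_add_distrib]
  refine sum_congr rfl fun y _ => ?_
  by_cases hx : x ∈ A <;> by_cases hy : y ∈ A
  · simp [spinAt, hx, hy]
  · rw [(hdec x y hx hy).1]; ring
  · rw [(hdec y x hy hx).2]; ring
  · simp only [spinAt, hx, hy, if_false]; ring

/-- **Independence of the two sides for decoupled couplings**: if `f` depends only on the spins in
`A` and `g` only on the spins off `A`, then `(Σ f g w)(Σ w) = (Σ f w)(Σ g w)` (the swap of the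
`Aᶜ`-parts of a pair of configurations is a weight-preserving involution). [folklore] -/
theorem sum_mul_sum_eq_of_decoupled {c : ι → ι → ℝ}
    (hdec : ∀ x y, x ∈ A → y ∉ A → c x y = 0 ∧ c y x = 0) (f g : SpinConfig ι → ℝ)
    (hf : ∀ ρ ρ' : SpinConfig ι, f (fun x => if x ∈ A then ρ x else ρ' x) = f ρ)
    (hg : ∀ ρ ρ' : SpinConfig ι, g (fun x => if x ∈ A then ρ x else ρ' x) = g ρ') :
    (∑ ρ : SpinConfig ι, f ρ * g ρ * weight c ρ) * (∑ ρ : SpinConfig ι, weight c ρ) =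
      (∑ ρ : SpinConfig ι, f ρ * weight c ρ) * ∑ ρ : SpinConfig ι, g ρ * weight c ρ := by
  classical
  set mix : SpinConfig ι → SpinConfig ι → SpinConfig ι :=
    fun ρ ρ' x => if x ∈ A then ρ x else ρ' x with hmix
  set Φ : SpinConfig ι × SpinConfig ι → SpinConfig ι × SpinConfig ι :=
    fun p => (mix p.1 p.2, mix p.2 p.1) with hΦ
  have hΦΦ : ∀ p, Φ (Φ p) = p := by
    rintro ⟨ρ, ρ'⟩
    show (mix (mix ρ ρ') (mix ρ' ρ), mix (mix ρ' ρ) (mix ρ ρ')) = (ρ, ρ')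
    rw [Prod.mk.injEq]
    exact ⟨mix_mix A ρ ρ', mix_mix A ρ' ρ⟩
  set e : SpinConfig ι × SpinConfig ι ≃ SpinConfig ι × SpinConfig ι :=
    { toFun := Φ, invFun := Φ, left_inv := hΦΦ, right_inv := hΦΦ } with he
  rw [Fintype.sum_mul_sum, Fintype.sum_mul_sum, ← Fintype.sum_prod_type', ← Fintype.sum_prod_type']
  refine Fintype.sum_equiv e _ _ fun p => ?_
  show f p.1 * g p.1 * weight c p.1 * weight c p.2 =
    f (mix p.1 p.2) * weight c (mix p.1 p.2) * (g (mix p.2 p.1) * weight c (mix p.2 p.1))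
  rw [hf, hg]
  have hw := weight_mix_mul_weight_mix A hdec p.1 p.2
  simp only [hmix] at hw ⊢
  linear_combination (-(f p.1 * g p.1)) * hw

end Decoupled

/-! ### 2. Camia–Jiang–Newman Thm 2 for a bridge coupling -/

section Bridge

variable {ι : Type} [Fintype ι] [DecidableEq ι]

/-- Restricting the weights to `A`: `X_{λ𝟙_A}` depends only on the spins in `A`. [folklore] -/
theorem weightedMagnetization_indicator_mix (A : Finset ι) (lam : ι → ℝ) (ρ ρ' : SpinConfig ι) :
    weightedMagnetization (fun x => if x ∈ A then lam x else 0)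
        (fun x => if x ∈ A then ρ x else ρ' x) =
      weightedMagnetization (fun x => if x ∈ A then lam x else 0) ρ := by
  unfold weightedMagnetization
  refine sum_congr rfl fun x _ => ?_
  by_cases hx : x ∈ A <;> simp [spinAt, hx]

/-- … and not on the spins off `A`. [folklore] -/
theorem weightedMagnetization_indicator_mix' (A : Finset ι) (lam : ι → ℝ) (ρ ρ' : SpinConfig ι) :
    weightedMagnetization (fun x => if x ∈ A then (0 : ℝ) else lam x)
        (fun x => if x ∈ A then ρ x else ρ' x) =
      weightedMagnetization (fun x => if x ∈ A then (0 : ℝ) else lam x) ρ' := by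
  unfold weightedMagnetization
  refine sum_congr rfl fun x _ => ?_
  by_cases hx : x ∈ A <;> simp [spinAt, hx]

/-- `X_λ = X_{λ𝟙_A} + X_{λ𝟙_{Aᶜ}}`. [folklore] -/
theorem weightedMagnetization_eq_add_indicator (A : Finset ι) (lam : ι → ℝ) (ρ : SpinConfig ι) :
    weightedMagnetization lam ρ =
      weightedMagnetization (fun x => if x ∈ A then lam x else 0) ρ +
        weightedMagnetization (fun x => if x ∈ A then (0 : ℝ) else lam x) ρ := by
  unfold weightedMagnetization
  rw [← sum_add_distrib]
  refine sum_congr rfl fun x _ => ?_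
  by_cases hx : x ∈ A <;> simp [hx]

end Bridge

section Bridge2

variable {ι : Type*} [Fintype ι] [DecidableEq ι]

/-- **Weight factorisation across one pair of entries**: with `c⁰` the couplings `c` with the
`(u,v)` and `(v,u)` entries set to `0` (`u ≠ v`),
`w_c(σ) = w_{c⁰}(σ) · (cosh J + σ_uσ_v sinh J)`, `J = c_{uv} + c_{vu}`. [folklore] -/
theorem weight_eq_weight_zeroPair_mul (c : ι → ι → ℝ) {u v : ι} (huv : u ≠ v) (ρ : SpinConfig ι) :
    weight c ρ = weight (setCoupling (setCoupling c u v 0) v u 0) ρ *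
      (Real.cosh (c u v + c v u) + spinAt u ρ * spinAt v ρ * Real.sinh (c u v + c v u)) := by
  set c0 := setCoupling (setCoupling c u v 0) v u 0 with hc0
  have hvu : c0 v u = 0 := by simp [hc0]
  have h1 : setCoupling c0 v u (c0 v u + c v u) = setCoupling c u v 0 := by
    rw [hvu, zero_add, hc0, setCoupling_setCoupling]
    have : c v u = (setCoupling c u v 0) v u := by
      unfold setCoupling
      rw [if_neg]
      rintro ⟨h1, _⟩
      exact huv h1.symm
    rw [this, setCoupling_self]
  have huv0 : (setCoupling c u v 0) u v = 0 := by simp [setCoupling]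
  have h2 : setCoupling (setCoupling c u v 0) u v ((setCoupling c u v 0) u v + c u v) = c := by
    rw [huv0, zero_add, setCoupling_setCoupling, setCoupling_self]
  have hw1 := weight_setCoupling_add c0 v u (c v u) ρ
  rw [h1] at hw1
  have hw2 := weight_setCoupling_add (setCoupling c u v 0) u v (c u v) ρ
  rw [h2] at hw2
  rw [hw2, hw1, mul_assoc, ← Real.exp_add]
  have : c v u * (spinAt v ρ * spinAt u ρ) + c u v * (spinAt u ρ * spinAt v ρ) =
      (c u v + c v u) * (spinAt u ρ * spinAt v ρ) := by ring
  rw [this, exp_mul_spin _ u v]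

/-- Sums against `w_c` in terms of sums against `w_{c⁰}`:
`Σ f w_c = cosh J · Σ f w_{c⁰} + sinh J · Σ σ_uσ_v f w_{c⁰}`. [folklore] -/
theorem sum_mul_weight_eq_zeroPair (c : ι → ι → ℝ) {u v : ι} (huv : u ≠ v)
    (f : SpinConfig ι → ℝ) :
    (∑ ρ : SpinConfig ι, f ρ * weight c ρ) =
      Real.cosh (c u v + c v u) *
          ∑ ρ : SpinConfig ι, f ρ * weight (setCoupling (setCoupling c u v 0) v u 0) ρ +
        Real.sinh (c u v + c v u) *
          ∑ ρ : SpinConfig ι, spinAt u ρ * spinAt v ρ * f ρ *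
            weight (setCoupling (setCoupling c u v 0) v u 0) ρ := by
  simp_rw [weight_eq_weight_zeroPair_mul c huv, mul_sum, ← sum_add_distrib]
  refine sum_congr rfl fun ρ _ => ?_
  ring

end Bridge2

section Bridge3

variable {ι : Type} [Fintype ι] [DecidableEq ι]

/-- **The pinned-sign inequality NG′ for a bridge.** Let the couplings `c ≥ 0` have no entries
between `A ∋ u` and `Aᶜ ∋ v` other than `(u,v)`, `(v,u)` (a bridge).  Then at the first zero
`θ⋆` of `θ ↦ ⟨cos θX⟩_c` one has `⟨σ_uσ_v cos θ⋆X⟩_c ≤ 0`.  Proof: with `c⁰` the decoupled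
couplings, `Z_c W⁰ = cosh J · Z₁Z₂ − sinh J · S₁S₂` and `N_c W⁰ = sinh J · Z₁Z₂ − cosh J · S₁S₂`
(`Z₁ = Σ cos(θX_A) w⁰`, `S₁ = Σ σ_u sin(θX_A) w⁰`, … by the independence of the two sides and
parity); the sides stay positive on `[0, θ⋆)` (else `Z_c ≤ 0` earlier), so `S₁(θ⋆), S₂(θ⋆) ≥ 0`
(`avg_spin_mul_sin_nonneg`) and `cosh J · N_c(θ⋆) W⁰ = −S₁S₂(θ⋆) ≤ 0`.
[cite: CamiaJiangNewman2023, Thm 2 (special case, proved here)] -/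
theorem avg_spin_pair_cos_nonpos_of_bridge {c : ι → ι → ℝ} (hc : ∀ a b, 0 ≤ c a b)
    {lam : ι → ℝ} (hlam : ∀ a, 0 ≤ lam a) (A : Finset ι) {u v : ι} (hu : u ∈ A) (hv : v ∉ A)
    (hbridge : ∀ x ∈ A, ∀ y ∉ A, (x ≠ u ∨ y ≠ v) → c x y = 0 ∧ c y x = 0)
    {θs : ℝ} (hθs : 0 < θs)
    (hposb : ∀ θ' ∈ Set.Ico (0 : ℝ) θs,
      0 < avg c (fun ρ => Real.cos (θ' * weightedMagnetization lam ρ)))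
    (hzs : avg c (fun ρ => Real.cos (θs * weightedMagnetization lam ρ)) = 0) :
    avg c (fun ρ => spinAt u ρ * spinAt v ρ * Real.cos (θs * weightedMagnetization lam ρ)) ≤ 0 := by
  classical
  have huv : u ≠ v := fun h => hv (h ▸ hu)
  -- the decoupled couplings and the two one-sided weight vectors
  set c0 : ι → ι → ℝ := setCoupling (setCoupling c u v 0) v u 0 with hc0
  set lamA : ι → ℝ := fun x => if x ∈ A then lam x else 0 with hlamA
  set lamB : ι → ℝ := fun x => if x ∈ A then (0 : ℝ) else lam x with hlamB
  have hc0nn : ∀ a b, 0 ≤ c0 a b := by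
    intro a b; simp only [hc0, setCoupling]; split_ifs <;> first | exact le_rfl | exact hc a b
  have hlamA0 : ∀ x, 0 ≤ lamA x := fun x => by simp only [hlamA]; split_ifs <;> simp [hlam x]
  have hlamB0 : ∀ x, 0 ≤ lamB x := fun x => by simp only [hlamB]; split_ifs <;> simp [hlam x]
  have hdec : ∀ x y, x ∈ A → y ∉ A → c0 x y = 0 ∧ c0 y x = 0 := by
    intro x y hx hy
    by_cases hxy : x = u ∧ y = v
    · obtain ⟨rfl, rfl⟩ := hxy
      simp [hc0, setCoupling, huv]
    · have hb := hbridge x hx y hy (by tauto)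
      have hxv : x ≠ v := fun h => hy (by rw [← h] at hv; exact absurd hx hv)
      have hyu : y ≠ u := fun h => hy (h ▸ hu)
      constructor
      · simp only [hc0, setCoupling]
        rw [if_neg (fun h => hxv h.1), if_neg hxy]
        exact hb.1
      · simp only [hc0, setCoupling]
        split_ifs
        · rfl
        · rfl
        · exact hb.2
  -- the players
  set J : ℝ := c u v + c v u with hJ
  set W0 : ℝ := ∑ ρ : SpinConfig ι, weight c0 ρ with hW0
  set Z1 : ℝ → ℝ := fun θ => ∑ ρ : SpinConfig ι,
    Real.cos (θ * weightedMagnetization lamA ρ) * weight c0 ρ with hZ1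
  set Z2 : ℝ → ℝ := fun θ => ∑ ρ : SpinConfig ι,
    Real.cos (θ * weightedMagnetization lamB ρ) * weight c0 ρ with hZ2
  set S1 : ℝ → ℝ := fun θ => ∑ ρ : SpinConfig ι,
    spinAt u ρ * Real.sin (θ * weightedMagnetization lamA ρ) * weight c0 ρ with hS1
  set S2 : ℝ → ℝ := fun θ => ∑ ρ : SpinConfig ι,
    spinAt v ρ * Real.sin (θ * weightedMagnetization lamB ρ) * weight c0 ρ with hS2
  have hW0pos : 0 < W0 := sum_weight_pos c0
  have hJ0 : 0 ≤ J := add_nonneg (hc u v) (hc v u)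
  -- independence identities
  have hmixA := weightedMagnetization_indicator_mix A lam
  have hmixB := weightedMagnetization_indicator_mix' A lam
  have hsplit : ∀ ρ : SpinConfig ι, weightedMagnetization lam ρ =
      weightedMagnetization lamA ρ + weightedMagnetization lamB ρ :=
    weightedMagnetization_eq_add_indicator A lam
  have hZid : ∀ θ, (∑ ρ : SpinConfig ι, Real.cos (θ * weightedMagnetization lam ρ) * weight c0 ρ) * W0 =
      Z1 θ * Z2 θ := by
    intro θ
    have h1 := sum_mul_sum_eq_of_decoupled A hdec
      (fun ρ => Real.cos (θ * weightedMagnetization lamA ρ))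
      (fun ρ => Real.cos (θ * weightedMagnetization lamB ρ))
      (fun ρ ρ' => by simp only [hlamA]; rw [hmixA]) (fun ρ ρ' => by simp only [hlamB]; rw [hmixB])
    have h2 := sum_mul_sum_eq_of_decoupled A hdec
      (fun ρ => Real.sin (θ * weightedMagnetization lamA ρ))
      (fun ρ => Real.sin (θ * weightedMagnetization lamB ρ))
      (fun ρ ρ' => by simp only [hlamA]; rw [hmixA]) (fun ρ ρ' => by simp only [hlamB]; rw [hmixB])
    rw [sum_sin_weight_eq_zero c0 lamA θ, zero_mul] at h2
    have h3 : (∑ ρ : SpinConfig ι, Real.cos (θ * weightedMagnetization lam ρ) * weight c0 ρ) =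
        (∑ ρ : SpinConfig ι, Real.cos (θ * weightedMagnetization lamA ρ) *
            Real.cos (θ * weightedMagnetization lamB ρ) * weight c0 ρ) -
          ∑ ρ : SpinConfig ι, Real.sin (θ * weightedMagnetization lamA ρ) *
            Real.sin (θ * weightedMagnetization lamB ρ) * weight c0 ρ := by
      rw [← sum_sub_distrib]
      refine sum_congr rfl fun ρ _ => ?_
      rw [hsplit ρ, mul_add, Real.cos_add]
      ring
    rw [h3, sub_mul, h1, h2, sub_zero]
  have hNid : ∀ θ, (∑ ρ : SpinConfig ι, spinAt u ρ * spinAt v ρ *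
      Real.cos (θ * weightedMagnetization lam ρ) * weight c0 ρ) * W0 = -(S1 θ * S2 θ) := by
    intro θ
    have h1 := sum_mul_sum_eq_of_decoupled A hdec
      (fun ρ => spinAt u ρ * Real.cos (θ * weightedMagnetization lamA ρ))
      (fun ρ => spinAt v ρ * Real.cos (θ * weightedMagnetization lamB ρ))
      (fun ρ ρ' => by simp only [hlamA, spinAt, hu, if_true]; rw [hmixA])
      (fun ρ ρ' => by simp only [hlamB, spinAt, hv, if_false]; rw [hmixB])
    rw [sum_spin_mul_cos_weight_eq_zero c0 lamA u θ, zero_mul] at h1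
    have h2 := sum_mul_sum_eq_of_decoupled A hdec
      (fun ρ => spinAt u ρ * Real.sin (θ * weightedMagnetization lamA ρ))
      (fun ρ => spinAt v ρ * Real.sin (θ * weightedMagnetization lamB ρ))
      (fun ρ ρ' => by simp only [hlamA, spinAt, hu, if_true]; rw [hmixA])
      (fun ρ ρ' => by simp only [hlamB, spinAt, hv, if_false]; rw [hmixB])
    have h3 : (∑ ρ : SpinConfig ι, spinAt u ρ * spinAt v ρ *
        Real.cos (θ * weightedMagnetization lam ρ) * weight c0 ρ) =
        (∑ ρ : SpinConfig ι, (spinAt u ρ * Real.cos (θ * weightedMagnetization lamA ρ)) *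
            (spinAt v ρ * Real.cos (θ * weightedMagnetization lamB ρ)) * weight c0 ρ) -
          ∑ ρ : SpinConfig ι, (spinAt u ρ * Real.sin (θ * weightedMagnetization lamA ρ)) *
            (spinAt v ρ * Real.sin (θ * weightedMagnetization lamB ρ)) * weight c0 ρ := by
      rw [← sum_sub_distrib]
      refine sum_congr rfl fun ρ _ => ?_
      rw [hsplit ρ, mul_add, Real.cos_add]
      ring
    rw [h3, sub_mul, h1, h2, zero_sub]
  -- coupled sums in terms of decoupled ones
  have hZc : ∀ θ, (∑ ρ : SpinConfig ι, Real.cos (θ * weightedMagnetization lam ρ) * weight c ρ) * W0 =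
      Real.cosh J * (Z1 θ * Z2 θ) - Real.sinh J * (S1 θ * S2 θ) := by
    intro θ
    rw [sum_mul_weight_eq_zeroPair c huv, add_mul, mul_assoc, mul_assoc, hZid θ]
    have : (∑ ρ : SpinConfig ι, spinAt u ρ * spinAt v ρ * Real.cos (θ * weightedMagnetization lam ρ) *
        weight (setCoupling (setCoupling c u v 0) v u 0) ρ) * W0 = -(S1 θ * S2 θ) := hNid θ
    rw [this]
    ring
  have hNc : ∀ θ, (∑ ρ : SpinConfig ι, spinAt u ρ * spinAt v ρ *
      Real.cos (θ * weightedMagnetization lam ρ) * weight c ρ) * W0 =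
      Real.sinh J * (Z1 θ * Z2 θ) - Real.cosh J * (S1 θ * S2 θ) := by
    intro θ
    rw [sum_mul_weight_eq_zeroPair c huv, add_mul, mul_assoc, mul_assoc, hNid θ]
    have h4 : (∑ ρ : SpinConfig ι, spinAt u ρ * spinAt v ρ *
        (spinAt u ρ * spinAt v ρ * Real.cos (θ * weightedMagnetization lam ρ)) *
          weight (setCoupling (setCoupling c u v 0) v u 0) ρ) =
        ∑ ρ : SpinConfig ι, Real.cos (θ * weightedMagnetization lam ρ) * weight c0 ρ := by
      refine sum_congr rfl fun ρ _ => ?_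
      have hu2 := spinAt_mul_self u ρ
      have hv2 := spinAt_mul_self v ρ
      have key : spinAt u ρ * spinAt v ρ *
          (spinAt u ρ * spinAt v ρ * Real.cos (θ * weightedMagnetization lam ρ)) =
          Real.cos (θ * weightedMagnetization lam ρ) := by
        calc spinAt u ρ * spinAt v ρ *
            (spinAt u ρ * spinAt v ρ * Real.cos (θ * weightedMagnetization lam ρ))
            = (spinAt u ρ * spinAt u ρ) * (spinAt v ρ * spinAt v ρ) *
                Real.cos (θ * weightedMagnetization lam ρ) := by ring
          _ = Real.cos (θ * weightedMagnetization lam ρ) := by rw [hu2, hv2, one_mul, one_mul]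
      rw [key]
    rw [h4, hZid θ]
    ring
  -- continuity of the one-sided sums
  have hZ1c : Continuous Z1 := by
    simp only [hZ1]
    refine continuous_finsetSum _ fun ρ _ => ?_
    exact (Real.continuous_cos.comp (continuous_id.mul continuous_const)).mul continuous_const
  have hZ2c : Continuous Z2 := by
    simp only [hZ2]
    refine continuous_finsetSum _ fun ρ _ => ?_
    exact (Real.continuous_cos.comp (continuous_id.mul continuous_const)).mul continuous_const
  have hZ10 : Z1 0 = W0 := by simp [hZ1, hW0]
  have hZ20 : Z2 0 = W0 := by simp [hZ2, hW0]
  -- translation between sums and Gibbs averages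
  have hZsum : ∀ θ, 0 < avg c (fun ρ => Real.cos (θ * weightedMagnetization lam ρ)) →
      0 < Real.cosh J * (Z1 θ * Z2 θ) - Real.sinh J * (S1 θ * S2 θ) := by
    intro θ hθ
    rw [← hZc θ]
    rw [avg_def] at hθ
    exact mul_pos ((div_pos_iff_of_pos_right (sum_weight_pos c)).1 hθ) hW0pos
  -- `S_i ≥ 0` at the right end of an interval of positivity of `Z_i`
  have hS1 : ∀ t, 0 ≤ t → (∀ θ ∈ Set.Ico (0 : ℝ) t, 0 < Z1 θ) → 0 ≤ S1 t := by
    intro t ht hpos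
    have key := avg_spin_mul_sin_nonneg hc0nn hlamA0 u ht (fun θ hθ => by
      rw [avg_def]
      exact div_pos (hpos θ hθ) hW0pos)
    rw [avg_def] at key
    have := (div_nonneg_iff).1 key
    rcases this with ⟨h1, _⟩ | ⟨_, h2⟩
    · exact h1
    · exact absurd h2 (not_le.2 hW0pos)
  have hS2 : ∀ t, 0 ≤ t → (∀ θ ∈ Set.Ico (0 : ℝ) t, 0 < Z2 θ) → 0 ≤ S2 t := by
    intro t ht hpos
    have key := avg_spin_mul_sin_nonneg hc0nn hlamB0 v ht (fun θ hθ => by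
      rw [avg_def]
      exact div_pos (hpos θ hθ) hW0pos)
    rw [avg_def] at key
    have := (div_nonneg_iff).1 key
    rcases this with ⟨h1, _⟩ | ⟨_, h2⟩
    · exact h1
    · exact absurd h2 (not_le.2 hW0pos)
  -- Claim A: both sides stay positive on `[0, θs)`
  have hsides : ∀ t ∈ Set.Ico (0 : ℝ) θs, 0 < Z1 t ∧ 0 < Z2 t := by
    by_contra hcon
    push Not at hcon
    obtain ⟨t₀, ht₀, hbad⟩ := hcon
    -- the first failure time
    set F : Set ℝ := Set.Icc 0 t₀ ∩ {t | Z1 t ≤ 0 ∨ Z2 t ≤ 0} with hF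
    have hFclosed : IsClosed F := by
      refine isClosed_Icc.inter ?_
      exact (isClosed_le hZ1c continuous_const).union (isClosed_le hZ2c continuous_const)
    have ht₀F : t₀ ∈ F := by
      refine ⟨⟨ht₀.1, le_rfl⟩, ?_⟩
      by_cases h1 : Z1 t₀ ≤ 0
      · exact Or.inl h1
      · exact Or.inr (hbad (not_le.1 h1))
    have hFne : F.Nonempty := ⟨t₀, ht₀F⟩
    have hFbdd : BddBelow F := ⟨0, fun x hx => hx.1.1⟩
    set τ := sInf F with hτ
    have hτF : τ ∈ F := hFclosed.csInf_mem hFne hFbdd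
    have hτle : τ ≤ t₀ := csInf_le hFbdd ht₀F
    have hτ0 : 0 ≤ τ := hτF.1.1
    have hτlt : τ < θs := hτle.trans_lt ht₀.2
    have hbefore : ∀ θ ∈ Set.Ico (0 : ℝ) τ, 0 < Z1 θ ∧ 0 < Z2 θ := by
      intro θ hθ
      by_contra hneg
      have hθF : θ ∈ F := by
        refine ⟨⟨hθ.1, hθ.2.le.trans hτle⟩, ?_⟩
        rcases not_and_or.1 hneg with h1 | h2
        · exact Or.inl (not_lt.1 h1)
        · exact Or.inr (not_lt.1 h2)
      have := csInf_le hFbdd hθF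
      linarith [hθ.2]
    have hτpos : 0 < τ := by
      rcases hτ0.lt_or_eq with h | h
      · exact h
      · exfalso
        rcases hτF.2 with h1 | h2
        · rw [← h, hZ10] at h1; linarith
        · rw [← h, hZ20] at h2; linarith
    have hS1τ : 0 ≤ S1 τ := hS1 τ hτ0 fun θ hθ => (hbefore θ hθ).1
    have hS2τ : 0 ≤ S2 τ := hS2 τ hτ0 fun θ hθ => (hbefore θ hθ).2
    -- limits: `Z1 τ ≥ 0`, `Z2 τ ≥ 0`
    have hlim : ∀ (Z : ℝ → ℝ), Continuous Z → (∀ θ ∈ Set.Ico (0 : ℝ) τ, 0 < Z θ) → 0 ≤ Z τ := by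
      intro Z hZc hZpos
      have hl : Filter.Tendsto Z (nhdsWithin τ (Set.Iio τ)) (nhds (Z τ)) :=
        hZc.continuousAt.tendsto.mono_left nhdsWithin_le_nhds
      have hev : ∀ᶠ θ in nhdsWithin τ (Set.Iio τ), (0 : ℝ) ≤ Z θ := by
        have hmem : Set.Ioo 0 τ ∈ nhdsWithin τ (Set.Iio τ) := Ioo_mem_nhdsLT hτpos
        filter_upwards [hmem] with θ hθ' using (hZpos θ ⟨hθ'.1.le, hθ'.2⟩).le
      exact ge_of_tendsto hl hev
    have hZ1τ : 0 ≤ Z1 τ := hlim Z1 hZ1c fun θ hθ => (hbefore θ hθ).1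
    have hZ2τ : 0 ≤ Z2 τ := hlim Z2 hZ2c fun θ hθ => (hbefore θ hθ).2
    have hprod : Z1 τ * Z2 τ ≤ 0 := by
      rcases hτF.2 with h1 | h2
      · exact mul_nonpos_of_nonpos_of_nonneg h1 hZ2τ
      · exact mul_nonpos_of_nonneg_of_nonpos hZ1τ h2
    have hpos := hZsum τ (hposb τ ⟨hτ0, hτlt⟩)
    have h5 : Real.cosh J * (Z1 τ * Z2 τ) ≤ 0 :=
      mul_nonpos_of_nonneg_of_nonpos (Real.cosh_pos J).le hprod
    have h6 : 0 ≤ Real.sinh J * (S1 τ * S2 τ) :=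
      mul_nonneg (Real.sinh_nonneg_iff.2 hJ0) (mul_nonneg hS1τ hS2τ)
    linarith
  -- Claim B: `S1 θs, S2 θs ≥ 0`
  have hS1s : 0 ≤ S1 θs := hS1 θs hθs.le fun θ hθ => (hsides θ hθ).1
  have hS2s : 0 ≤ S2 θs := hS2 θs hθs.le fun θ hθ => (hsides θ hθ).2
  -- at `θs`: `cosh J · Z1 Z2 = sinh J · S1 S2`, hence `cosh J · N W0 = -S1 S2 ≤ 0`
  have hZ0 : Real.cosh J * (Z1 θs * Z2 θs) - Real.sinh J * (S1 θs * S2 θs) = 0 := by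
    rw [← hZc θs]
    rw [avg_def, div_eq_zero_iff] at hzs
    rcases hzs with h | h
    · rw [h, zero_mul]
    · exact absurd h (sum_weight_pos c).ne'
  have hkey : Real.cosh J * ((∑ ρ : SpinConfig ι, spinAt u ρ * spinAt v ρ *
      Real.cos (θs * weightedMagnetization lam ρ) * weight c ρ) * W0) = -(S1 θs * S2 θs) := by
    rw [hNc θs]
    have hZ0' : Real.cosh J * (Z1 θs * Z2 θs) = Real.sinh J * (S1 θs * S2 θs) := by linarith
    have hcs := Real.cosh_sq_sub_sinh_sq J
    calc Real.cosh J * (Real.sinh J * (Z1 θs * Z2 θs) - Real.cosh J * (S1 θs * S2 θs))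
        = Real.sinh J * (Real.cosh J * (Z1 θs * Z2 θs)) - Real.cosh J ^ 2 * (S1 θs * S2 θs) := by
          ring
      _ = Real.sinh J * (Real.sinh J * (S1 θs * S2 θs)) - Real.cosh J ^ 2 * (S1 θs * S2 θs) := by
          rw [hZ0']
      _ = -(S1 θs * S2 θs) * (Real.cosh J ^ 2 - Real.sinh J ^ 2) := by ring
      _ = -(S1 θs * S2 θs) := by rw [hcs, mul_one]
  have hnum : (∑ ρ : SpinConfig ι, spinAt u ρ * spinAt v ρ *
      Real.cos (θs * weightedMagnetization lam ρ) * weight c ρ) ≤ 0 := by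
    have hneg : Real.cosh J * ((∑ ρ : SpinConfig ι, spinAt u ρ * spinAt v ρ *
        Real.cos (θs * weightedMagnetization lam ρ) * weight c ρ) * W0) ≤ 0 := by
      rw [hkey]; exact neg_nonpos.2 (mul_nonneg hS1s hS2s)
    by_contra hp
    push Not at hp
    have : 0 < Real.cosh J * ((∑ ρ : SpinConfig ι, spinAt u ρ * spinAt v ρ *
        Real.cos (θs * weightedMagnetization lam ρ) * weight c ρ) * W0) :=
      mul_pos (Real.cosh_pos J) (mul_pos hp hW0pos)
    linarith
  rw [avg_def]
  exact div_nonpos_iff.2 (Or.inr ⟨hnum, (sum_weight_pos c).le⟩)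

end Bridge3

section Bridge4

variable {ι : Type} [Fintype ι] [DecidableEq ι]

/-- **The single-coupling step, local form** (copy of `exists_zero_le_of_raise` with the
pinned-sign inequality assumed only for the model at hand): if `c ≥ 0`, `λ ≥ 0`, `u ≠ v`, `δ ≥ 0`,
NG′ holds for `(c; u, v)` at every first zero, and `h` is a zero of the `c`-mgf, then the mgf of
`c + δ·𝟙_{(u,v)}` has a zero of no larger modulus. [cite: CamiaJiangNewman2023, Thm 2]
[cite: HouJiangNewman2023, Lemma 3] -/
theorem exists_zero_le_of_raise_of_pinnedSign {c : ι → ι → ℝ} {lam : ι → ℝ} {u v : ι}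
    (hN : ∀ θ : ℝ, 0 < θ →
      (∀ θ' ∈ Set.Ico (0 : ℝ) θ,
        0 < avg c (fun ρ => Real.cos (θ' * weightedMagnetization lam ρ))) →
      avg c (fun ρ => Real.cos (θ * weightedMagnetization lam ρ)) = 0 →
      avg c (fun ρ => spinAt u ρ * spinAt v ρ *
        Real.cos (θ * weightedMagnetization lam ρ)) ≤ 0)
    (hc : ∀ a b, 0 ≤ c a b) (hlam : ∀ a, 0 ≤ lam a) {δ : ℝ} (hδ : 0 ≤ δ)
    {h : ℂ} (hz : mgf c lam h = 0) :
    ∃ h' : ℂ, mgf (setCoupling c u v (c u v + δ)) lam h' = 0 ∧ ‖h'‖ ≤ ‖h‖ := by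
  obtain ⟨θ, hθpos, hθle, hθz⟩ := PairIsing.exists_cos_zero_of_mgf_eq_zero hc hlam hz
  obtain ⟨θs, hθs, hθsle, hzs, hposb⟩ := exists_firstZero_le c lam hθpos.le hθz
  have hNs := hN θs hθs hposb hzs
  set c' := setCoupling c u v (c u v + δ) with hc'
  set g : ℝ → ℝ := fun θ' => avg c' (fun ρ => Real.cos (θ' * weightedMagnetization lam ρ))
    with hg
  have hZ : 0 < ∑ ρ : SpinConfig ι, weight c ρ := sum_weight_pos c
  have hnum0 : (∑ ρ : SpinConfig ι,
      Real.cos (θs * weightedMagnetization lam ρ) * weight c ρ) = 0 := by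
    have h0 := hzs
    rw [avg_def, div_eq_zero_iff] at h0
    exact h0.resolve_right hZ.ne'
  have hnumN : (∑ ρ : SpinConfig ι,
      spinAt u ρ * spinAt v ρ * Real.cos (θs * weightedMagnetization lam ρ) * weight c ρ) ≤ 0 := by
    have h1 := hNs
    rw [avg_def, div_le_iff₀ hZ, zero_mul] at h1
    exact h1
  have hgθs : g θs ≤ 0 := by
    show avg c' (fun ρ => Real.cos (θs * weightedMagnetization lam ρ)) ≤ 0
    rw [avg_def, hc', sum_cos_weight_setCoupling, hnum0, mul_zero, zero_add]
    refine div_nonpos_iff.2 (Or.inr ⟨?_, (sum_weight_pos _).le⟩)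
    exact mul_nonpos_of_nonneg_of_nonpos (Real.sinh_nonneg_iff.2 hδ) hnumN
  have hg0 : g 0 = 1 := avg_cos_zero c' lam
  have hcont : Continuous g := continuous_avg_cos c' lam
  have hivt : (0 : ℝ) ∈ g '' Set.Icc 0 θs := by
    have hsub := intermediate_value_Icc' hθs.le hcont.continuousOn
    exact hsub ⟨hgθs, by rw [hg0]; exact zero_le_one⟩
  obtain ⟨θ'', hθ'', hgz⟩ := hivt
  refine ⟨(θ'' : ℂ) * I, ?_, ?_⟩
  · rw [mgf_mul_I]
    exact_mod_cast hgz
  · rw [norm_mul, norm_I, mul_one, norm_real, Real.norm_eq_abs, abs_of_nonneg hθ''.1]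
    exact hθ''.2.trans (hθsle.trans hθle)

/-- **Camia–Jiang–Newman 2023, Theorem 2, for a bridge coupling (proved).** Let `c ≥ 0` be
ferromagnetic pair couplings on a finite set, `λ ≥ 0`, and let `A` be a set of sites with
`u ∈ A`, `v ∉ A` such that the only couplings between `A` and its complement are the entries
`(u,v)`, `(v,u)` (the edge `uv` is a BRIDGE of the interaction graph; e.g. any edge of a forest).
Then raising the `(u,v)` coupling can only lower the first Lee–Yang zero, in the zero form of
`CamiaJiangNewman2023_thm2`: every zero `h` of `⟨e^{hX}⟩_c` has a zero `h'` of
`⟨e^{hX}⟩_{c + δ𝟙_{(u,v)}}` with `‖h'‖ ≤ ‖h‖`.  (Elementary consequence of the Lee–Yang theorem: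
`avg_spin_pair_cos_nonpos_of_bridge` + the single-coupling step; the general case — arbitrary
edges — is the named fact `CamiaJiangNewman2023_thm2`, not proved in the tree.)
[cite: CamiaJiangNewman2023, Thm 2 (special case)] -/
theorem CamiaJiangNewman2023_thm2_bridge {c : ι → ι → ℝ} (hc : ∀ a b, 0 ≤ c a b)
    {lam : ι → ℝ} (hlam : ∀ a, 0 ≤ lam a) (A : Finset ι) {u v : ι} (hu : u ∈ A) (hv : v ∉ A)
    (hbridge : ∀ x ∈ A, ∀ y ∉ A, (x ≠ u ∨ y ≠ v) → c x y = 0 ∧ c y x = 0)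
    {δ : ℝ} (hδ : 0 ≤ δ) {h : ℂ} (hz : mgf c lam h = 0) :
    ∃ h' : ℂ, mgf (setCoupling c u v (c u v + δ)) lam h' = 0 ∧ ‖h'‖ ≤ ‖h‖ :=
  exists_zero_le_of_raise_of_pinnedSign
    (fun _θ hθ hposb hzs => avg_spin_pair_cos_nonpos_of_bridge hc hlam A hu hv hbridge hθ hposb hzs)
    hc hlam hδ hz

end Bridge4

end PairIsing

end Literature.Probability.LatticeModels
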